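import Summits.ResolutionOfSingularities.ResolutionOfSingularities.Theorems.RadicialJungCleanModelsKbarQuasiProjectiveModel
import HarnessLib

/-!
# Route `RadicialJung`, crux `CleanModels` (stmt-15917): the dim-`≤ 3` slice of the crux FIELD BY FIELD — over a given ground field `k` it follows
# from the Cossart–Posva rational normal form over that `k` ALONE

Explicit-unit seat `decomp-res-hand-1` g23 (share: the printed stubs 1–4 of `Cruxes/CleanModels/Lines/Sketch.lean` rev 35).  OURS, def-free, counted 0.
Companion of `…KbarQuasiProjectiveModel.lean` (same seat, ✓ p838114/p838135: regular quasi-projective models of regular threefolds over any field; the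
`k = k̄` slice from `Cossart1987ThmRational` alone).  Nothing here proves resolution of singularities in characteristic `p`, and NO printed theorem is
bound: the Cossart-type statement over `k` enters as an explicit HYPOTHESIS `hCRk` (the conclusion shape of the typed named fact
`Literature.AlgebraicGeometry.Resolution.Cossart1987ThmRational`, read over the fixed field `k`; in print ONLY for `k` algebraically closed —
[Posva2024] Claim 5.1.2 / App. A §A.7 — and [Posva2024] Rem. 5.1.8 records that the methods of [Cos87b] are not functorial, so no descent to
smaller fields is in print).

* `cleanModelsAt_dimThree_of_cossartRationalOver` — for EVERY field `k` of characteristic `p`: `hCRk` ⟹ the pointwise conclusion of the crux for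
  every regular integral separated threefold `W` of finite type over `k` (quasi-projective regular model ✓ + `hCRk` on it + packaging ✓).
* `cleanModelsAt_dimLEThree_of_cossartRationalOver` — the same for `dim W ≤ 3` (dimension `≤ 2` unconditional, ✓ F-75c).

Census reading: on {`dim W ≤ 3`} the crux over `k` is implied by ONE Cossart-type statement over `k`; for `k = k̄` that statement is printed
(✓ `KbarQuasiProjective.cleanModels_algClosed_dimLEThree_of_cossartRational`), for perfect / imperfect `k` it is the research target, and the
hypothesis `CP2008.ResolutionQuasiProjectiveThreefolds` of ✓ `KbarRational.cleanModelsAt_dimLEThree_perfect_of_cossartRationalPerfect_of_cp2008` (g22)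
is superfluous.

References: Posva 2024 (arXiv:2405.05735) Claim 5.1.2, App. A §A.7, Rem. 5.1.8 [Posva2024]; Cossart–Piltant 2019 Prop. 4.4 [CossartPiltant2019];
The Stacks Project Tag 081T [StacksProject].
-/

noncomputable section

set_option linter.dupNamespace false -- mandated namespace of this single-conjunct summit

open IsLocalRing
open Literature.AlgebraicGeometry.Resolution
open Summit.ResolutionOfSingularities.ResolutionOfSingularities.Theorems.RadicialJung.CleanModels
open CategoryTheory AlgebraicGeometry TopologicalSpace
open Literature.AlgebraicGeometry.CossartPiltant200819.CP2008
open Literature.AlgebraicGeometry.Motives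

namespace Summit.ResolutionOfSingularities.ResolutionOfSingularities.Theorems.RadicialJung.CleanModels.KbarQuasiProjective

/-- **For EVERY ground field `k`: `CleanModels` in dimension `3` over `k` follows from the Cossart–Posva rational normal form over `k` ALONE**
(companion file, same seat).  The hypothesis `hCRk` is the conclusion shape of the typed named fact `Cossart1987ThmRational`, read for regular
QUASI-PROJECTIVE threefolds over the FIXED field `k` (no `IsAlgClosed k`; for `k = k̄` it is `hCR p k`, for perfect `k` it is the research
statement spelled out in ✓ `KbarRational.cleanModelsAt_dimThree_perfect_of_cossartRationalPerfect_of_cp2008` — NOT in print off `k̄`: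
[Posva2024] Rem. 5.1.8 records that the methods of [Cos87b] are not functorial).  Conclusion: the pointwise conclusion of the crux for every regular
integral separated threefold `W` of finite type over `k`.  Proof: `exists_quasiProjective_regular_model_dimThree` (any field) + `hCRk` on the model +
packaging ✓ `KbarRational.cleanModelsAt_of_nuZeroAt_closedPoints` (every field).  So on {`dim W ≤ 3`} the crux over a given `k` is implied by ONE
Cossart-type statement over that `k` and nothing else — the census reading of the dim-3 slice field by field.
[cite: Posva2024, Claim 5.1.2, App. A §A.7 and Rem. 5.1.8] [cite: CossartPiltant2019, Prop. 4.4] [cite: StacksProject, Tag 081T] -/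
theorem cleanModelsAt_dimThree_of_cossartRationalOver
    (p : ℕ) (hp : p.Prime) (k : Type) [Field k] [CharP k p]
    (hCRk : ∀ (X : Scheme.{0}) [IsIntegral X] [CompactSpace X] (sX : X ⟶ Spec (.of k))
      [LocallyOfFiniteType sX] [IsSeparated sX],
      IsQuasiProjectiveOver sX → Scheme.IsRegular X → topologicalKrullDim X = 3 →
      ∀ u : X.functionField, (∀ c : X.functionField, c ^ p ≠ u) →
      ∃ (X' : Scheme.{0}) (π : X' ⟶ X) (_ : IsIntegral X') (_ : IsDominant π),
        IsProper π ∧ Scheme.IsRegular X' ∧ (∃ U : X.Opens, (U : Set X).Nonempty ∧ IsIso (π ∣_ U)) ∧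
        ∀ x' : X', ∃ (v : X.functionField) (g : X'.presheaf.stalk x'), v ≠ 0 ∧
          algebraMap (X'.presheaf.stalk x') X'.functionField g = RatFn.functionFieldMap π (u * v ^ p) ∧
          NuZeroAt g)
    (W : Scheme.{0}) [IsIntegral W] (f : W ⟶ Spec (.of k)) [IsSeparated f] [LocallyOfFiniteType f]
    [QuasiCompact f] (hW : Scheme.IsRegular W) (hdim : topologicalKrullDim W = 3)
    (L : Type) [Field L] [Algebra W.functionField L]
    [IsPurelyInseparable W.functionField L] (hdeg : Module.finrank W.functionField L = p) :
    ∃ (V : Scheme.{0}) (π : V ⟶ W) (_ : IsIntegral V) (_ : IsDominant π),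
      IsProper π ∧ IsBirational π ∧ Scheme.IsRegular V ∧
      (∀ v : V, (∃ (y : L) (g : W.functionField), y ∉ Set.range (algebraMap W.functionField L) ∧
        algebraMap W.functionField L g = y ^ p ∧
        ((∃ (d m : ℕ) (hmd : m ≤ d) (t : Fin d → V.presheaf.stalk v) (a : Fin m → ℕ),
            Ideal.span (Set.range t) = maximalIdeal (V.presheaf.stalk v) ∧
            ringKrullDim (V.presheaf.stalk v) = (d : WithBot ℕ∞) ∧ 0 < m ∧ (∀ i, ¬ p ∣ a i) ∧
            RatFn.functionFieldMap π g = ∏ i : Fin m,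
              (algebraMap (V.presheaf.stalk v) V.functionField (t (Fin.castLE hmd i))) ^ (a i)) ∨
          (∃ u₀ : V.presheaf.stalk v, IsUnit u₀ ∧
            RatFn.functionFieldMap π g = algebraMap (V.presheaf.stalk v) V.functionField u₀ ∧
            ((∀ c : V.presheaf.stalk v, u₀ - c ^ p ∉ maximalIdeal (V.presheaf.stalk v)) ∨
              (∃ c : V.presheaf.stalk v, u₀ - c ^ p ∈ maximalIdeal (V.presheaf.stalk v) ∧
                u₀ - c ^ p ∉ maximalIdeal (V.presheaf.stalk v) ^ 2)))))) := by
  classical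
  haveI : Fact p.Prime := ⟨hp⟩
  haveI : CharP W.functionField p := charP_stalk W f _
  obtain ⟨-, y₀, g₀, hy₀, hg₀, hg₀p⟩ := stub_generator (K := W.functionField) (L := L) p hp hdeg
  /- a regular quasi-projective proper birational model `σ : X₂ → W` -/
  obtain ⟨X₂, σ, hX₂int, hσprop, hbir₂, hX₂reg, hqp₂, hdim₂⟩ :=
    exists_quasiProjective_regular_model_dimThree k W f hW hdim
  haveI := hX₂int
  haveI := hσprop
  haveI : IsDominant σ := hbir₂.isDominant
  let f₂ : X₂ ⟶ Spec (.of k) := σ ≫ f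
  obtain ⟨hlft₂, hsep₂, hqc₂⟩ := hqp₂.finiteType_isSeparated_quasiCompact
  haveI := hlft₂; haveI := hsep₂; haveI := hqc₂
  haveI : CompactSpace X₂ := QuasiCompact.compactSpace_of_compactSpace f₂
  have hbij₂ : Function.Bijective (RatFn.functionFieldMap σ) := by
    obtain ⟨U', hU', hU'', hiso⟩ := hbir₂
    haveI := hiso
    exact RatFn.functionFieldMap_bijective_of_isIso_morphismRestrict σ U' hU' hU''
  let u₂ : X₂.functionField := RatFn.functionFieldMap σ g₀
  have hu₂ : ∀ c : X₂.functionField, c ^ p ≠ u₂ := by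
    intro c hc
    obtain ⟨c', rfl⟩ := hbij₂.2 c
    exact hg₀p c' (hbij₂.1 (by rw [map_pow]; exact hc))
  /- the Cossart-type statement over `k` on `X₂` -/
  obtain ⟨V, π₃, hVint, hdom₃, hπ₃, hVreg, ⟨U₂, hU₂ne, hiso₂⟩, hν⟩ := hCRk X₂ f₂ hqp₂ hX₂reg hdim₂ u₂ hu₂
  haveI := hVint
  haveI := hdom₃
  haveI := hπ₃
  haveI := hiso₂
  obtain ⟨hbir₃, -⟩ := Lens5.KbarCossart.isBirational_and_denseRange π₃ U₂ hU₂ne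
  /- the composite and the transported representatives -/
  let π : V ⟶ W := π₃ ≫ σ
  have hbir : IsBirational π := hbir₃.comp hbir₂
  haveI hdom : IsDominant π := hbir.isDominant
  haveI : IsProper π := inferInstance
  have hcomp : ∀ z : W.functionField,
      RatFn.functionFieldMap π z = RatFn.functionFieldMap π₃ (RatFn.functionFieldMap σ z) := fun z =>
    RingHom.congr_fun (RatFn.functionFieldMap_comp σ π₃) z
  have hν' : ∀ x : V, IsClosed ({x} : Set V) → ∃ (v : W.functionField) (g : V.presheaf.stalk x), v ≠ 0 ∧
      algebraMap (V.presheaf.stalk x) V.functionField g = RatFn.functionFieldMap π (g₀ * v ^ p) ∧ NuZeroAt g := by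
    intro x _
    obtain ⟨v₂, g, hv₂, hg, hN⟩ := hν x
    obtain ⟨v, rfl⟩ := hbij₂.2 v₂
    refine ⟨v, g, fun h0 => hv₂ (by rw [h0, map_zero]), ?_, hN⟩
    rw [hg, hcomp]
    simp only [map_mul, map_pow, u₂]
  exact ⟨V, π, hVint, hdom, inferInstance, hbir, hVreg, fun x =>
    KbarRational.cleanModelsAt_of_nuZeroAt_closedPoints p hp k W f L y₀ g₀ hy₀ hg₀ V π hbir hVreg hν' x⟩

/-- **Field by field, `dim W ≤ 3`**: the crux over a given `k` from the Cossart–Posva statement over that `k` (dimension `≤ 2` unconditional,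
✓ F-75c).  In particular the hypothesis `CP2008.ResolutionQuasiProjectiveThreefolds` of
✓ `KbarRational.cleanModelsAt_dimLEThree_perfect_of_cossartRationalPerfect_of_cp2008` is superfluous. [cite: Posva2024, Claim 5.1.2 and App. A §A.7]
[cite: StacksProject, Tag 0BIC] -/
theorem cleanModelsAt_dimLEThree_of_cossartRationalOver
    (p : ℕ) (hp : p.Prime) (k : Type) [Field k] [CharP k p]
    (hCRk : ∀ (X : Scheme.{0}) [IsIntegral X] [CompactSpace X] (sX : X ⟶ Spec (.of k))
      [LocallyOfFiniteType sX] [IsSeparated sX],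
      IsQuasiProjectiveOver sX → Scheme.IsRegular X → topologicalKrullDim X = 3 →
      ∀ u : X.functionField, (∀ c : X.functionField, c ^ p ≠ u) →
      ∃ (X' : Scheme.{0}) (π : X' ⟶ X) (_ : IsIntegral X') (_ : IsDominant π),
        IsProper π ∧ Scheme.IsRegular X' ∧ (∃ U : X.Opens, (U : Set X).Nonempty ∧ IsIso (π ∣_ U)) ∧
        ∀ x' : X', ∃ (v : X.functionField) (g : X'.presheaf.stalk x'), v ≠ 0 ∧
          algebraMap (X'.presheaf.stalk x') X'.functionField g = RatFn.functionFieldMap π (u * v ^ p) ∧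
          NuZeroAt g)
    (W : Scheme.{0}) [IsIntegral W] (f : W ⟶ Spec (.of k)) [IsSeparated f] [LocallyOfFiniteType f]
    [QuasiCompact f] (hW : Scheme.IsRegular W) (hdim : topologicalKrullDim W ≤ 3)
    (L : Type) [Field L] [Algebra W.functionField L]
    [IsPurelyInseparable W.functionField L] (hdeg : Module.finrank W.functionField L = p) :
    ∃ (V : Scheme.{0}) (π : V ⟶ W) (_ : IsIntegral V) (_ : IsDominant π),
      IsProper π ∧ IsBirational π ∧ Scheme.IsRegular V ∧
      (∀ v : V, (∃ (y : L) (g : W.functionField), y ∉ Set.range (algebraMap W.functionField L) ∧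
        algebraMap W.functionField L g = y ^ p ∧
        ((∃ (d m : ℕ) (hmd : m ≤ d) (t : Fin d → V.presheaf.stalk v) (a : Fin m → ℕ),
            Ideal.span (Set.range t) = maximalIdeal (V.presheaf.stalk v) ∧
            ringKrullDim (V.presheaf.stalk v) = (d : WithBot ℕ∞) ∧ 0 < m ∧ (∀ i, ¬ p ∣ a i) ∧
            RatFn.functionFieldMap π g = ∏ i : Fin m,
              (algebraMap (V.presheaf.stalk v) V.functionField (t (Fin.castLE hmd i))) ^ (a i)) ∨
          (∃ u₀ : V.presheaf.stalk v, IsUnit u₀ ∧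
            RatFn.functionFieldMap π g = algebraMap (V.presheaf.stalk v) V.functionField u₀ ∧
            ((∀ c : V.presheaf.stalk v, u₀ - c ^ p ∉ maximalIdeal (V.presheaf.stalk v)) ∨
              (∃ c : V.presheaf.stalk v, u₀ - c ^ p ∈ maximalIdeal (V.presheaf.stalk v) ∧
                u₀ - c ^ p ∉ maximalIdeal (V.presheaf.stalk v) ^ 2)))))) := by
  rcases le_two_or_eq_three_of_le_three hdim with h2 | h3
  · exact cleanModels_dimLETwo_of_f75c stub_stacks0BICLocus p hp k W f hW L hdeg h2
  · exact cleanModelsAt_dimThree_of_cossartRationalOver p hp k hCRk W f hW h3 L hdeg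

end Summit.ResolutionOfSingularities.ResolutionOfSingularities.Theorems.RadicialJung.CleanModels.KbarQuasiProjective

end
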